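import Summits.BirchSwinnertonDyer.BirchSwinnertonDyer.Theorems.ClassRecordThreeHsiehDescentSharp
import Summits.BirchSwinnertonDyer.BirchSwinnertonDyer.Theorems.ClassRecordThreeDefs
import Summits.BirchSwinnertonDyer.BirchSwinnertonDyer.Theses.KolyvaginRoadThree

/-!
# Glue of the (SHARPENED) layer-2 split of item 19108 `HsiehDescentAtThree` — closes glue item stmt-BirchSwinnertonDyer-19240
# (routes `ClassRecordThree` rev 4 ∕ `KolyvaginRoadThree` rev 2: planner g23 `--split` 02:34Z then `--restate OpenValueReciprocityAtThree`
# to bdp g10's SHARP K5-B statement, new child item stmt-BirchSwinnertonDyer-19281)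

Cell `bsd-stepL`, seat `bsd-stepL-bdp` (prover g10). Closes the generated glue item 19240
`HsiehDescentAtThreeOfChildren : TateSenVanishingAtThree → OpenValueReciprocityAtThree → HsiehDescentAtThree`
(after the restate, `OpenValueReciprocityAtThree` IS the sharp statement on both routes)
by the landed SHARP reduction
`Summit.BirchSwinnertonDyer.Rank1Residual.X11b.Three.BdpSeat.classRecordThree_hsiehDescentAtThree_of_tateSenCharacter_of_sharpValueReciprocity`
(p417285; Tate–Sen fact p414875; the restated child `OpenValueReciprocityAtThree` (item 19281) is that theorem's hypothesis `hVR` VERBATIM, fully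
qualified, so the term type-checks by δ-unfolding of the two child defs — certified beforehand in
`bdp/kernel-g10/split-19108-sharp/GlueTestSharp.lean`, farm rc 0, axioms standard). The two children stay OPEN items
(`TateSenVanishingAtThree` 19238 = the named Literature fact, cite-only; `OpenValueReciprocityAtThree` 19281 = SHARP K5-B, the crux); this file
asserts only the implication. HONEST FRAMING: a glue closure; no crux, no class of atom O2@3, no census word.
-/

namespace Summit.BirchSwinnertonDyer.BirchSwinnertonDyer.Theorems

/-- The glue item 19240 of the sharpened split of `HsiehDescentAtThree` (route `ClassRecordThree` rev 4): the printed Tate–Sen theorem at 3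
and the sharp value-reciprocity clause imply the crux, by the landed sharp reduction (p417285).
[cite: BrinonConrad2009, Thm. 2.2.7] [cite: BertoliniDarmonPrasanna2013, Thm. 5.4 and Lemma 5.3 (shape of the sharp child only; nothing asserted)] -/
theorem hsiehDescentAtThreeOfChildren_holds :
    Summit.BirchSwinnertonDyer.BirchSwinnertonDyer.Theses.ClassRecordThree.HsiehDescentAtThreeOfChildren :=
  fun h₁ h₂ ↦
    Summit.BirchSwinnertonDyer.Rank1Residual.X11b.Three.BdpSeat.classRecordThree_hsiehDescentAtThree_of_tateSenCharacter_of_sharpValueReciprocity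
      h₁ h₂

/-- The same glue item as rendered in route `KolyvaginRoadThree` (shared item; the two copies are definitionally equal).
[cite: BrinonConrad2009, Thm. 2.2.7] -/
theorem kolyvaginRoadThree_hsiehDescentAtThreeOfChildren_holds :
    Summit.BirchSwinnertonDyer.BirchSwinnertonDyer.Theses.KolyvaginRoadThree.HsiehDescentAtThreeOfChildren :=
  fun h₁ h₂ ↦
    Summit.BirchSwinnertonDyer.Rank1Residual.X11b.Three.BdpSeat.classRecordThree_hsiehDescentAtThree_of_tateSenCharacter_of_sharpValueReciprocity
      h₁ h₂

/-- The restated (SHARP) split child `OpenValueReciprocityAtThree` of route `ClassRecordThree` (item 19281) IS, by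
definitional unfolding, the by-name statement `∀ W, Theorems.ValueReciprocityBAtThree W` (`Theorems/ClassRecordThreeDefs.lean`,
p417714) — so a proof of either form serves the item. [folklore] -/
theorem classRecordThree_openValueReciprocityAtThree_iff_forall_valueReciprocityBAtThree :
    Summit.BirchSwinnertonDyer.BirchSwinnertonDyer.Theses.ClassRecordThree.OpenValueReciprocityAtThree ↔
      ∀ (W : WeierstrassCurve ℚ) [W.IsElliptic] [W.IsGloballyMinimal], ValueReciprocityBAtThree W :=
  Iff.rfl

/-- The same identification for the SHARED item's copy in route `KolyvaginRoadThree` (after its identical restate). [folklore] -/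
theorem kolyvaginRoadThree_openValueReciprocityAtThree_iff_forall_valueReciprocityBAtThree :
    Summit.BirchSwinnertonDyer.BirchSwinnertonDyer.Theses.KolyvaginRoadThree.OpenValueReciprocityAtThree ↔
      ∀ (W : WeierstrassCurve ℚ) [W.IsElliptic] [W.IsGloballyMinimal], ValueReciprocityBAtThree W :=
  Iff.rfl

end Summit.BirchSwinnertonDyer.BirchSwinnertonDyer.Theorems
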